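import Summits.BirchSwinnertonDyer.BirchSwinnertonDyer.Theses.CountingDoorF2AtThree
import Literature.NumberTheory.EllipticCurves.VariableChangePoints
import Literature.NumberTheory.EllipticCurves.TwistFamilySelmerGroupCardInvarianceProofs
import HarnessLib

/-!
# BirchSwinnertonDyer / CountingDoorF2AtThree — support for crux I1 `SelmerThreeAverageLargeF2`
# (stmt-BirchSwinnertonDyer-19440): the FIBRED EMBEDDING `F₂ ↪ F₁ × (chord data)` of the
# orbit-counting line `shared-face-rubik-pairs`

Route `route-BirchSwinnertonDyer-CountingDoorF2AtThree` (cell bsd-rank2; seat `bsd-rank2-sel3-p2`,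
the ORBIT-COUNTING lane on I1). The only orbit object named for `(F₂, 3)` is the crux card
`Cruxes/SelmerThreeAverageLargeF2/Ideas/shared-face-rubik-pairs.md`: pairs of `3 × 3 × 3` cubes
sharing a face; its FIBRED FORM ("Why it bites (3)") reads a member of Bhargava–Ho's `F₂` as a
member of their one-marked-point family `F₁ = {y² + A₃ y = x³ + A₂ x² + A₄ x}` (marked point
`(0,0)`; `3`-Selmer elements parametrised by Rubik's cubes, BH22 Thm. 3.1 line 4) TOGETHER WITH a
second integral point `(r, r t)` whose chord through `(0, 0)` has INTEGRAL slope `t`, the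
`F₁`-invariants lying on the plane `r A₂ − t A₃ + A₄ = r t² − r²`. This file proves that
dictionary member by member, with no hypothesis and no named fact:

* §1 the explicit admissible change of variables `C_a = (u, r, s, t) = (1/2, a₂, −a₁/2, 0)`:
  `C_a • E_a = [0, A₂, A₃, A₄, 0]` with `A₂ = 12a₂ + a₁²`, `A₃ = 8(a₃ + a₁a₂)`,
  `A₄ = 16(a₂ − a₂')(2a₂ + a₂') + 8a₁(a₃ + a₁a₂)` (`fibred_smul_curve`), discriminant
  `Δ = 2¹² Δ(a)` (`fibred_Δ`); the marked points go to `(0, 0)` and `(r, r t)` with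
  `r = 4(a₂' − a₂)`, `t = a₁` (`pointEquiv_fibred_markedPoint₁/₂`), the third root `(a₂'', 0)`
  to `(−4(2a₂ + a₂'), −4a₁(2a₂ + a₂'))`; the PENCIL IDENTITY `r A₂ − t A₃ + A₄ = r t² − r²`
  (`fibred_pencil_identity`, over `ℤ`); `#Sel₃(C_a • E_a) = #Sel₃(E_a)` (`natCard_selmerGroup_fibred`,
  the tree's `natCard_selmerGroup_smul`);
* §2 the parameter map `a ↦ (A₂, A₃, r, t)` is INJECTIVE on `ℤ⁴` (`fibredParams_injective`) with the
  congruences `A₂ ≡ t² (mod 12)`, `8 ∣ A₃`, `4 ∣ r` describing its image, and `A₄` is determined by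
  the pencil identity — so `F₂`-parameter space is the `(r, t)`-resolution `W′//G ≅ 𝔸⁴` of the card;
* §3 height bookkeeping: `|t|¹² ≤ H(a)`, `|r|⁶ ≤ 2¹⁸ H(a)`, `|A₂|⁶ ≤ 13⁶ H(a)`-type bounds in the
  integer form `|A₂| ≤ 12|a₂| + a₁²` etc., which place the image of `Φ(<X)` in a box of
  `F₁`-height `≪ X` and chords `|r| ≪ X^{1/6}`, `|t| ≤ X^{1/12}`.

What this is NOT: no count. The open content of I1 on this line is the lattice-point statement
HE(33) of the card (equidistribution of the Rubik-cube invariant map on the pencil of planes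
`Π_{r,t}`), which is not a geometry-of-numbers statement in print (nearest print technology:
Shankar–Siad–Swaminathan, PLMS 2025 = arXiv:2304.01050, integral points on symmetric varieties in
fundamental domains — one FIXED coefficient, not a two-parameter pencil of degree-12 invariant
hypersurfaces). PARTITION: none — r_an ≥ 2, summit axis S0; TWIN (D-0056): n/a. B1 honesty:
Weierstrass-model algebra; nothing reads a Selmer average, a root number or an analytic rank.

References: M. Bhargava, W. Ho, arXiv:2207.03309 (2022) §1 (families `F₁`, `F₂`), Thm. 3.1
[BhargavaHo2022]; M. Bhargava, W. Ho, *Coregular spaces and genus one curves*, Camb. J. Math. 4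
(2016) Thm. 3.1 (Rubik's cubes ↔ `(C, L, P)`) [arXiv:1306.4424]; J. H. Silverman, *AEC* III.1
Table 3.1, III.3.1(b), X.4.2 [SilvermanAEC2009].
-/

set_option linter.dupNamespace false

noncomputable section

open scoped Classical
open WeierstrassCurve Literature.NumberTheory.EllipticCurves
  Literature.NumberTheory.EllipticCurves.BhargavaHo2022
  Summit.BirchSwinnertonDyer.BirchSwinnertonDyer.Theses.CountingDoorF2AtThree

namespace Summit.BirchSwinnertonDyer.BirchSwinnertonDyer.Theorems

/-! ### §1 The change of variables `(1/2, a₂, −a₁/2, 0)` to the `F₁`-model with two integral points -/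

/-- `(1/2)⁻¹ = 2` in `ℚˣ` (the scaling `u = 1/2` of the fibred change of variables). [folklore] -/
private theorem units_mk0_half_inv : ((Units.mk0 (2⁻¹ : ℚ) (by norm_num))⁻¹ : ℚˣ) = Units.mk0 2 (by norm_num) := by
  ext; simp

/-- **The `F₁`-model of a member of `F₂`.** For `a = (a₁, a₂, a₂', a₃)` the admissible change of
variables `C_a = (u, r, s, t) = (1/2, a₂, −a₁/2, 0)` (move `P₁ = (a₂, 0)` to the origin, kill the
`xy`-term, rescale by `2`) takes `E_a : y² + a₁xy + a₃y = (x − a₂)(x − a₂')(x + a₂ + a₂')` to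
Bhargava–Ho's one-marked-point shape `y² + A₃ y = x³ + A₂ x² + A₄ x`, i.e. Weierstrass coefficients
`[0, A₂, A₃, A₄, 0]` with `A₂ = 12a₂ + a₁²`, `A₃ = 8(a₃ + a₁a₂)`,
`A₄ = 16(a₂ − a₂')(2a₂ + a₂') + 8a₁(a₃ + a₁a₂)` — all integers.
[cite: BhargavaHo2022, §1 (definitions of F₁ and F₂)] -/
theorem fibred_smul_curve (a : Params) :
    (⟨Units.mk0 (2⁻¹ : ℚ) (by norm_num), (a.a₂ : ℚ), -(a.a₁ : ℚ) / 2, 0⟩ : VariableChange ℚ) •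
        a.curve =
      ⟨0, ((12 * a.a₂ + a.a₁ ^ 2 : ℤ) : ℚ), ((8 * (a.a₃ + a.a₁ * a.a₂) : ℤ) : ℚ),
        ((16 * (a.a₂ - a.a₂') * (2 * a.a₂ + a.a₂') + 8 * a.a₁ * (a.a₃ + a.a₁ * a.a₂) : ℤ) : ℚ),
        0⟩ := by
  rw [Params.curve_eq]
  ext
  all_goals simp only [variableChange_a₁, variableChange_a₂, variableChange_a₃, variableChange_a₄,
    variableChange_a₆, units_mk0_half_inv, Units.val_mk0]
  all_goals push_cast
  all_goals ring

/-- The `F₁`-model has discriminant `2¹² Δ(a)` (`Δ` scales by `u⁻¹²`), in particular it is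
nonsingular exactly when `a` is a member. [cite: SilvermanAEC2009, III.1 Table 3.1 (Δ' = u⁻¹²Δ)] -/
theorem fibred_Δ (a : Params) :
    ((⟨Units.mk0 (2⁻¹ : ℚ) (by norm_num), (a.a₂ : ℚ), -(a.a₁ : ℚ) / 2, 0⟩ : VariableChange ℚ) •
        a.curve).Δ = 2 ^ 12 * (a.curveInt.Δ : ℚ) := by
  rw [variableChange_Δ, Params.curve_Δ]
  norm_num [units_mk0_half_inv, Units.val_mk0]

/-- **The pencil identity.** With `r = 4(a₂' − a₂)` and `t = a₁` the `F₁`-invariants of a member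
of `F₂` satisfy the AFFINE-LINEAR relation `r A₂ − t A₃ + A₄ = r t² − r²` — the statement that
`(r, r t)` lies on `y² + A₃ y = x³ + A₂ x² + A₄ x`, divided by `r` (an identity in `ℤ[a₁, a₂, a₂', a₃]`,
valid also at `r = 0`). [cite: BhargavaHo2022, §1 (definitions of F₁ and F₂)] -/
theorem fibred_pencil_identity (a : Params) :
    4 * (a.a₂' - a.a₂) * (12 * a.a₂ + a.a₁ ^ 2) - a.a₁ * (8 * (a.a₃ + a.a₁ * a.a₂)) +
        (16 * (a.a₂ - a.a₂') * (2 * a.a₂ + a.a₂') + 8 * a.a₁ * (a.a₃ + a.a₁ * a.a₂)) =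
      4 * (a.a₂' - a.a₂) * a.a₁ ^ 2 - (4 * (a.a₂' - a.a₂)) ^ 2 := by
  ring

/-- The point `(r, r t) = (4(a₂' − a₂), 4a₁(a₂' − a₂))` lies on the `F₁`-model
`y² + A₃ y = x³ + A₂ x² + A₄ x` (polynomial identity; it is the image of the marked point `P₂`).
[cite: BhargavaHo2022, §1 (definitions of F₁ and F₂)] -/
theorem fibred_equation_chordPoint (a : Params) :
    (⟨0, ((12 * a.a₂ + a.a₁ ^ 2 : ℤ) : ℚ), ((8 * (a.a₃ + a.a₁ * a.a₂) : ℤ) : ℚ),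
        ((16 * (a.a₂ - a.a₂') * (2 * a.a₂ + a.a₂') + 8 * a.a₁ * (a.a₃ + a.a₁ * a.a₂) : ℤ) : ℚ),
        0⟩ : WeierstrassCurve ℚ).toAffine.Equation ((4 * (a.a₂' - a.a₂) : ℤ) : ℚ)
      ((4 * a.a₁ * (a.a₂' - a.a₂) : ℤ) : ℚ) := by
  rw [WeierstrassCurve.Affine.equation_iff]
  push_cast
  ring

/-- The origin `(0, 0)` lies on the `F₁`-model (it is the image of the marked point `P₁`).
[cite: BhargavaHo2022, §1 (F₁: the marked point (0,0))] -/
theorem fibred_equation_origin (a : Params) :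
    (⟨0, ((12 * a.a₂ + a.a₁ ^ 2 : ℤ) : ℚ), ((8 * (a.a₃ + a.a₁ * a.a₂) : ℤ) : ℚ),
        ((16 * (a.a₂ - a.a₂') * (2 * a.a₂ + a.a₂') + 8 * a.a₁ * (a.a₃ + a.a₁ * a.a₂) : ℤ) : ℚ),
        0⟩ : WeierstrassCurve ℚ).toAffine.Equation 0 0 := by
  rw [WeierstrassCurve.Affine.equation_iff]
  ring

/-- The new coordinates of a point `(x, 0)` of `E_a` under `C_a`: `x' = 4(x − a₂)`,
`y' = 4a₁(x − a₂)` (Silverman III.1: `x' = u⁻²(x − r)`, `y' = u⁻³(y − s(x − r) − t)`).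
[cite: SilvermanAEC2009, III.1 Table 3.1] -/
theorem fibred_toXY (a : Params) (x : ℚ) :
    (⟨Units.mk0 (2⁻¹ : ℚ) (by norm_num), (a.a₂ : ℚ), -(a.a₁ : ℚ) / 2, 0⟩ : VariableChange ℚ).toX x =
        4 * (x - a.a₂) ∧
      (⟨Units.mk0 (2⁻¹ : ℚ) (by norm_num), (a.a₂ : ℚ), -(a.a₁ : ℚ) / 2, 0⟩ : VariableChange ℚ).toY
          x 0 = 4 * a.a₁ * (x - a.a₂) := by
  rw [VariableChange.toX_def, VariableChange.toY_def, units_mk0_half_inv]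
  simp only [Units.val_mk0]
  constructor <;> ring

/-- **`P₁ ↦ (0, 0)`.** Under the point-group isomorphism `pointEquiv` of `C_a` (tree file
`VariableChangePoints`), the first marked point `P₁ = (a₂, 0)` of a member goes to the marked point
`(0, 0)` of the `F₁`-model. [cite: BhargavaHo2022, §1 (F₁: marked point (0,0); F₂: marked point (a₂,0))] -/
theorem pointEquiv_fibred_markedPoint₁ {a : Params} (h : a.IsMember) :
    ∃ h₀ : ((⟨Units.mk0 (2⁻¹ : ℚ) (by norm_num), (a.a₂ : ℚ), -(a.a₁ : ℚ) / 2, 0⟩ :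
        VariableChange ℚ) • a.curve).toAffine.Nonsingular 0 0,
      VariableChange.pointEquiv a.curve
          (⟨Units.mk0 (2⁻¹ : ℚ) (by norm_num), (a.a₂ : ℚ), -(a.a₁ : ℚ) / 2, 0⟩ : VariableChange ℚ)
          (Params.markedPoint₁ h) = .some _ _ h₀ := by
  obtain ⟨hx, hy⟩ := fibred_toXY a (a.a₂ : ℚ)
  simp only [sub_self, mul_zero] at hx hy
  have hns := (VariableChange.nonsingular_iff a.curve
    (⟨Units.mk0 (2⁻¹ : ℚ) (by norm_num), (a.a₂ : ℚ), -(a.a₁ : ℚ) / 2, 0⟩ : VariableChange ℚ)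
    (a.a₂ : ℚ) 0).mpr ((WeierstrassCurve.Affine.equation_iff_nonsingular_of_Δ_ne_zero
      (by rw [Params.curve_Δ]; exact_mod_cast h)).mp a.equation_markedPoint₁)
  rw [hx, hy] at hns
  refine ⟨hns, ?_⟩
  rw [Params.markedPoint₁, VariableChange.pointEquiv_some]
  simp only [hx, hy]

/-- **`P₂ ↦ (r, r t)`** with `r = 4(a₂' − a₂)`, `t = a₁`: the second marked point `P₂ = (a₂', 0)`
goes to the INTEGRAL point `(4(a₂' − a₂), 4a₁(a₂' − a₂))` of the `F₁`-model, whose chord through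
`(0, 0)` has integral slope `t = a₁`. [cite: BhargavaHo2022, §1 (F₂: marked point (a₂',0))] -/
theorem pointEquiv_fibred_markedPoint₂ {a : Params} (h : a.IsMember) :
    ∃ h₀ : ((⟨Units.mk0 (2⁻¹ : ℚ) (by norm_num), (a.a₂ : ℚ), -(a.a₁ : ℚ) / 2, 0⟩ :
        VariableChange ℚ) • a.curve).toAffine.Nonsingular ((4 * (a.a₂' - a.a₂) : ℤ) : ℚ)
          ((4 * a.a₁ * (a.a₂' - a.a₂) : ℤ) : ℚ),
      VariableChange.pointEquiv a.curve
          (⟨Units.mk0 (2⁻¹ : ℚ) (by norm_num), (a.a₂ : ℚ), -(a.a₁ : ℚ) / 2, 0⟩ : VariableChange ℚ)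
          (Params.markedPoint₂ h) = .some _ _ h₀ := by
  obtain ⟨hx, hy⟩ := fibred_toXY a (a.a₂' : ℚ)
  have hx' : (⟨Units.mk0 (2⁻¹ : ℚ) (by norm_num), (a.a₂ : ℚ), -(a.a₁ : ℚ) / 2, 0⟩ :
      VariableChange ℚ).toX (a.a₂' : ℚ) = ((4 * (a.a₂' - a.a₂) : ℤ) : ℚ) := by
    rw [hx]; push_cast; ring
  have hy' : (⟨Units.mk0 (2⁻¹ : ℚ) (by norm_num), (a.a₂ : ℚ), -(a.a₁ : ℚ) / 2, 0⟩ :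
      VariableChange ℚ).toY (a.a₂' : ℚ) 0 = ((4 * a.a₁ * (a.a₂' - a.a₂) : ℤ) : ℚ) := by
    rw [hy]; push_cast; ring
  have hns := (VariableChange.nonsingular_iff a.curve
    (⟨Units.mk0 (2⁻¹ : ℚ) (by norm_num), (a.a₂ : ℚ), -(a.a₁ : ℚ) / 2, 0⟩ : VariableChange ℚ)
    (a.a₂' : ℚ) 0).mpr ((WeierstrassCurve.Affine.equation_iff_nonsingular_of_Δ_ne_zero
      (by rw [Params.curve_Δ]; exact_mod_cast h)).mp a.equation_markedPoint₂)
  rw [hx', hy'] at hns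
  refine ⟨hns, ?_⟩
  rw [Params.markedPoint₂, VariableChange.pointEquiv_some]
  simp only [hx', hy']

/-- **`#Sel₃(C_a • E_a) = #Sel₃(E_a)`** on members: the `3`-Selmer group is attached to the curve,
not to the equation (tree theorem `natCard_selmerGroup_smul`: descent count X.4.2 + invariance of
rank, torsion and `Ш ⊓ H¹[3]` under admissible changes of variables). So the I1 average may be
computed on the `F₁`-models. [cite: SilvermanAEC2009, Thm. X.4.2 with III.3.1(b)] -/
theorem natCard_selmerGroup_fibred {a : Params} (h : a.IsMember) :
    Nat.card (((⟨Units.mk0 (2⁻¹ : ℚ) (by norm_num), (a.a₂ : ℚ), -(a.a₁ : ℚ) / 2, 0⟩ :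
        VariableChange ℚ) • a.curve).selmerGroup 3) = Nat.card (a.curve.selmerGroup 3) := by
  haveI := Params.isElliptic_curve h
  have h3 := natCard_selmerGroup_smul a.curve
    (⟨Units.mk0 (2⁻¹ : ℚ) (by norm_num), (a.a₂ : ℚ), -(a.a₁ : ℚ) / 2, 0⟩ : VariableChange ℚ)
    (n := 3) (by norm_num)
  exact_mod_cast h3

/-! ### §2 The parameter map `a ↦ (A₂, A₃, r, t)` is injective; congruences of its image -/

/-- **Injectivity of the fibred parameters.** The map
`(a₁, a₂, a₂', a₃) ↦ (A₂, A₃, r, t) = (12a₂ + a₁², 8(a₃ + a₁a₂), 4(a₂' − a₂), a₁)` is injective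
on `ℤ⁴`: `a₁ = t`, `12a₂ = A₂ − t²`, `4a₂' = r + 4a₂`, `8a₃ = A₃ − 8ta₂` (so the chord datum `(r, t)`
and the `F₁`-invariants `(A₂, A₃)` recover the member; `A₄` is then forced by the pencil identity —
the card's `W′//G ≅ 𝔸⁴ ∋ (A₂, A₃, r, t)`). [cite: BhargavaHo2022, §1 (definitions of F₁ and F₂)] -/
theorem fibredParams_injective : Function.Injective fun a : Params ↦
    (12 * a.a₂ + a.a₁ ^ 2, 8 * (a.a₃ + a.a₁ * a.a₂), 4 * (a.a₂' - a.a₂), a.a₁) := by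
  rintro ⟨a₁, a₂, a₂', a₃⟩ ⟨b₁, b₂, b₂', b₃⟩ h
  simp only [Prod.mk.injEq] at h
  obtain ⟨h2, h3, hr, rfl⟩ := h
  have ha₂ : a₂ = b₂ := by omega
  subst ha₂
  have ha₂' : a₂' = b₂' := by omega
  subst ha₂'
  have ha₃ : a₃ = b₃ := by
    have : 8 * a₃ = 8 * b₃ := by linarith
    omega
  subst ha₃
  rfl

/-- Congruences cutting out the image of the fibred parameter map: `A₂ ≡ t² (mod 12)`, `8 ∣ A₃`,
`4 ∣ r` (and conversely any `(A₂, A₃, r, t) ∈ ℤ⁴` with these congruences comes from exactly one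
`a`, by `fibredParams_injective` and the displayed inverse). [folklore] -/
theorem fibredParams_congruences (a : Params) :
    (12 : ℤ) ∣ (12 * a.a₂ + a.a₁ ^ 2) - a.a₁ ^ 2 ∧ (8 : ℤ) ∣ 8 * (a.a₃ + a.a₁ * a.a₂) ∧
      (4 : ℤ) ∣ 4 * (a.a₂' - a.a₂) :=
  ⟨⟨a.a₂, by ring⟩, dvd_mul_right 8 _, dvd_mul_right 4 _⟩

/-- The inverse of the fibred parameter map on its image, stated without fractions: if
`A₂ = 12b + t²`, `r = 4c` and `A₃ = 8d` then `a = (t, b, b + c, d − tb)` has fibred parameters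
`(A₂, A₃, r, t)` — so the image is EXACTLY the congruence set `{A₂ ≡ t² (12), 8 ∣ A₃, 4 ∣ r}` of
`fibredParams_congruences`, and `F₂`-parameter space is identified with it. [folklore] -/
theorem fibredParams_surjective_onto_congruenceImage (t b c d : ℤ) :
    (fun a : Params ↦ (12 * a.a₂ + a.a₁ ^ 2, 8 * (a.a₃ + a.a₁ * a.a₂), 4 * (a.a₂' - a.a₂), a.a₁))
        ⟨t, b, b + c, d - t * b⟩ = (12 * b + t ^ 2, 8 * d, 4 * c, t) := by
  refine Prod.ext ?_ (Prod.ext ?_ (Prod.ext ?_ ?_)) <;> dsimp only <;> ring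

/-! ### §3 Height bookkeeping: the image of `F₂(<X)` lies in a box of `F₁`-size `≪ X` with short chords -/

/-- `|t|¹² = |a₁|¹² ≤ H(a)`: the chord slope is at most `H^{1/12}`. [cite: BhargavaHo2022, §1 (height on F₂)] -/
theorem abs_chordT_pow_le_height (a : Params) : |a.a₁| ^ 12 ≤ a.height := by
  unfold Params.height
  exact le_trans (le_max_left _ _) (le_trans (le_max_left _ _)
    (le_trans (le_max_left _ _) (le_max_left _ _)))

/-- `|a₂|⁶ ≤ H(a)` and `|a₂'|⁶ ≤ H(a)` and `|a₂ + a₂'|⁶ ≤ H(a)` and `|a₃|⁴ ≤ H(a)` (the other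
coordinates of Bhargava–Ho's height). [cite: BhargavaHo2022, §1 (height on F₂)] -/
theorem abs_pow_le_height (a : Params) : |a.a₂| ^ 6 ≤ a.height ∧ |a.a₂'| ^ 6 ≤ a.height ∧
    |a.a₂ + a.a₂'| ^ 6 ≤ a.height ∧ |a.a₃| ^ 4 ≤ a.height := by
  unfold Params.height
  refine ⟨?_, ?_, ?_, le_max_right _ _⟩
  · exact le_trans (le_max_right _ _) (le_trans (le_max_left _ _)
      (le_trans (le_max_left _ _) (le_max_left _ _)))
  · exact le_trans (le_max_right _ _) (le_trans (le_max_left _ _) (le_max_left _ _))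
  · exact le_trans (le_max_right _ _) (le_max_left _ _)

/-- **The chord is short: `|r|⁶ ≤ 2¹⁸ H(a)`** (`r = 4(a₂' − a₂)`, `|a₂' − a₂| ≤ 2 max(|a₂|, |a₂'|)`,
so `|r| ≤ 8 H^{1/6}`). [cite: BhargavaHo2022, §1 (height on F₂)] -/
theorem abs_chordR_pow_le_height (a : Params) : |4 * (a.a₂' - a.a₂)| ^ 6 ≤ 2 ^ 18 * a.height := by
  obtain ⟨h₂, h₂', -, -⟩ := abs_pow_le_height a
  set M := max |a.a₂| |a.a₂'| with hM
  have hM0 : 0 ≤ M := le_trans (abs_nonneg _) (le_max_left _ _)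
  have hM6 : M ^ 6 ≤ a.height := by
    rcases le_total |a.a₂| |a.a₂'| with hle | hle
    · rw [hM, max_eq_right hle]; exact h₂'
    · rw [hM, max_eq_left hle]; exact h₂
  have hr : |4 * (a.a₂' - a.a₂)| ≤ 8 * M := by
    rw [abs_mul, Nat.abs_ofNat]
    have : |a.a₂' - a.a₂| ≤ |a.a₂'| + |a.a₂| := abs_sub _ _
    have h1 : |a.a₂'| ≤ M := le_max_right _ _
    have h2 : |a.a₂| ≤ M := le_max_left _ _
    linarith
  calc |4 * (a.a₂' - a.a₂)| ^ 6 ≤ (8 * M) ^ 6 :=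
        pow_le_pow_left₀ (abs_nonneg _) hr 6
    _ = 2 ^ 18 * M ^ 6 := by ring
    _ ≤ 2 ^ 18 * a.height := by gcongr

/-- **Integer size bounds for the `F₁`-invariants** in terms of the `F₂`-coordinates:
`|A₂| ≤ 12|a₂| + a₁²`, `|A₃| ≤ 8(|a₃| + |a₁||a₂|)`,
`|A₄| ≤ 16|a₂ − a₂'||2a₂ + a₂'| + 8|a₁|(|a₃| + |a₁||a₂|)` — with `|a₁| ≤ H^{1/12}`, `|a₂|, |a₂'| ≤ H^{1/6}`,
`|a₃| ≤ H^{1/4}` these give `|A₂| ≤ 13 H^{1/6}`, `|A₃| ≤ 16 H^{1/4}`, `|A₄| ≤ 112 H^{1/3}`, i.e. the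
`F₁`-height `max(|A₂|⁶, |A₃|⁴, |A₄|³)` of the image is `≤ 13⁶ H(a)`. [folklore] -/
theorem abs_fibredInvariants_le (a : Params) :
    |12 * a.a₂ + a.a₁ ^ 2| ≤ 12 * |a.a₂| + a.a₁ ^ 2 ∧
      |8 * (a.a₃ + a.a₁ * a.a₂)| ≤ 8 * (|a.a₃| + |a.a₁| * |a.a₂|) ∧
      |16 * (a.a₂ - a.a₂') * (2 * a.a₂ + a.a₂') + 8 * a.a₁ * (a.a₃ + a.a₁ * a.a₂)| ≤
        16 * |a.a₂ - a.a₂'| * |2 * a.a₂ + a.a₂'| + 8 * |a.a₁| * (|a.a₃| + |a.a₁| * |a.a₂|) := by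
  refine ⟨?_, ?_, ?_⟩
  · calc |12 * a.a₂ + a.a₁ ^ 2| ≤ |12 * a.a₂| + |a.a₁ ^ 2| := abs_add_le _ _
      _ = 12 * |a.a₂| + a.a₁ ^ 2 := by rw [abs_mul, Nat.abs_ofNat, abs_pow, sq_abs]
  · rw [abs_mul, Nat.abs_ofNat]
    gcongr
    calc |a.a₃ + a.a₁ * a.a₂| ≤ |a.a₃| + |a.a₁ * a.a₂| := abs_add_le _ _
      _ = |a.a₃| + |a.a₁| * |a.a₂| := by rw [abs_mul]
  · calc |16 * (a.a₂ - a.a₂') * (2 * a.a₂ + a.a₂') + 8 * a.a₁ * (a.a₃ + a.a₁ * a.a₂)|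
        ≤ |16 * (a.a₂ - a.a₂') * (2 * a.a₂ + a.a₂')| + |8 * a.a₁ * (a.a₃ + a.a₁ * a.a₂)| :=
          abs_add_le _ _
      _ = 16 * |a.a₂ - a.a₂'| * |2 * a.a₂ + a.a₂'| + 8 * |a.a₁| * |a.a₃ + a.a₁ * a.a₂| := by
          simp only [abs_mul, Nat.abs_ofNat]
      _ ≤ 16 * |a.a₂ - a.a₂'| * |2 * a.a₂ + a.a₂'| + 8 * |a.a₁| * (|a.a₃| + |a.a₁| * |a.a₂|) := by
          gcongr
          calc |a.a₃ + a.a₁ * a.a₂| ≤ |a.a₃| + |a.a₁ * a.a₂| := abs_add_le _ _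
            _ = |a.a₃| + |a.a₁| * |a.a₂| := by rw [abs_mul]

/-! ### §4 Summary: the dictionary `(E_a; P₁, P₂) ≅ (E^{F₁}_{A(a)}; (0,0), (r, rt))` with equal `#Sel₃` -/

/-- **The fibred embedding, packaged.** Every member `a` of `F₂` admits an admissible change of
variables to a curve `y² + A₃ y = x³ + A₂ x² + A₄ x` in Bhargava–Ho's one-marked-point shape
(`A₂, A₃, A₄ ∈ ℤ` the explicit polynomials of §1), carrying `P₁ ↦ (0, 0)` and
`P₂ ↦ (r, r t) = (4(a₂' − a₂), 4a₁(a₂' − a₂))` and preserving `#Sel₃`; the `F₁`-invariants lie on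
the plane `r A₂ − t A₃ + A₄ = r t² − r²` (`fibred_pencil_identity`) and `(A₂, A₃, r, t)`
determines `a` (`fibredParams_injective`). This is the member-wise half of the card's transfer
`I1 ⟸ HE(33)`; the counting half (Rubik-cube classes with invariants on the pencil) is the open
content. [cite: BhargavaHo2022, §1 and Thm. 3.1 (line 4: 3 ⊗ 3 ⊗ 3 parametrises 3-Selmer elements of F₁)] -/
theorem exists_fibredEmbedding {a : Params} (h : a.IsMember) :
    ∃ C : VariableChange ℚ,
      C • a.curve = ⟨0, ((12 * a.a₂ + a.a₁ ^ 2 : ℤ) : ℚ), ((8 * (a.a₃ + a.a₁ * a.a₂) : ℤ) : ℚ),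
        ((16 * (a.a₂ - a.a₂') * (2 * a.a₂ + a.a₂') + 8 * a.a₁ * (a.a₃ + a.a₁ * a.a₂) : ℤ) : ℚ),
        0⟩ ∧
      (∃ h₀ : (C • a.curve).toAffine.Nonsingular 0 0,
        VariableChange.pointEquiv a.curve C (Params.markedPoint₁ h) = .some _ _ h₀) ∧
      (∃ h₀ : (C • a.curve).toAffine.Nonsingular ((4 * (a.a₂' - a.a₂) : ℤ) : ℚ)
          ((4 * a.a₁ * (a.a₂' - a.a₂) : ℤ) : ℚ),
        VariableChange.pointEquiv a.curve C (Params.markedPoint₂ h) = .some _ _ h₀) ∧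
      Nat.card ((C • a.curve).selmerGroup 3) = Nat.card (a.curve.selmerGroup 3) :=
  ⟨_, fibred_smul_curve a, pointEquiv_fibred_markedPoint₁ h, pointEquiv_fibred_markedPoint₂ h,
    natCard_selmerGroup_fibred h⟩

end Summit.BirchSwinnertonDyer.BirchSwinnertonDyer.Theorems

end
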